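import Summits.BirchSwinnertonDyer.BirchSwinnertonDyer.Theorems.GenusKolyvaginAtTwoPowDvdShaCardAtTwoRTOrderFourAuxiliaryAvoidingRat
import Summits.BirchSwinnertonDyer.BirchSwinnertonDyer.Theorems.GenusKolyvaginAtTwoPowDvdShaCardAtTwoRTOrderFourAuxiliaryDeepCanonical
import Summits.BirchSwinnertonDyer.BirchSwinnertonDyer.Theorems.GenusKolyvaginAtTwoPowDvdShaCardAtTwoRTBottomRungEngine
import HarnessLib

/-!
# Route `GenusKolyvaginAtTwo`, crux L_T `PowDvdShaCardAtTwoRT` (stmt-BirchSwinnertonDyer-23242), LINE 18 stub L, bottom rung: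
# THE S-bot AUXILIARY WITH DEEP ORTHOGONALITY, AVOIDING A FINITE SET `B` (the LW phantom) — `#B < 2^{#s}`

Width seat `bsd-line-gk2-p4` g18 (cell `bsd-f1-sign2`), `--supports 23242 --as helper`.  THEOREMS ONLY (no definition, no named fact,
no `sorry`; standard axioms).  Sequel of `…RTOrderFourAuxiliaryDeep` (p703833) and `…RTOrderFourAuxiliaryAvoiding(Rat)`.
BSD is NOT proved by any of this; neither is the crux nor stub L.

WHY (LEAD memo `Lines/plus-descent-lead-g16.md` §11 finding (B)).  The LEAD's `false_of_bottomRung_engine` (p704665) asks the Kolyvagin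
machine to serve EVERY auxiliary `y` with `2•y ≠ 0`; for `2•y = φ₄` (the Lawson–Wuthrich phantom, which dies at every level-`4` Kolyvagin
prime) no Čebotarev prime gives `loc_{ℓ′} y` order `4`.  This file lets the engine EXCLUDE such `y`: the auxiliary is produced with
**`2•y ∉ B`** for any finite set `B` of global classes with `#B < 2^{#s}` (`s` = the free own primes), keeping the deep orthogonality and
the vanishing of the `l′`-term — so `hstep` may assume `2•y ∉ B` (`B = {0, φ₄}` needs `#s ≥ 2`).
* `exists_localConditions_deep` — Step 1 of p703833 as a lemma: at every place of `T` a local condition `M_u` (`⊤` on `s`, order `≥ 8`,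
  orthogonal on `T ∖ s` to `loc(2•Z)` for `2•Z` transverse).
* **`exists_auxiliary_four_two_nsmul_not_mem_deep`**, **`exists_auxiliary_bottomRung_not_mem`**, `…_not_mem_canonical`.
* §2 **`RelaxedCount.false_of_bottomRung_engine_not_mem`** — the LEAD's one-step engine `false_of_bottomRung_engine` (p704665) VERBATIM with
  `hstep` required only for the auxiliaries `y` with `2•y ∉ B` (`#B < 2^{#s}`; `hs : s.Nonempty` dropped).
HONEST FRAMING: bookkeeping over p703833 / the Avoiding count; closes nothing.  BSD is NOT proved by any of this.

References: [McCallumLMS1991] §2 Prop. 2.1, §5 proof of Prop. 5.2 (13); [MilneADT2006] Ch. I Thm. 4.10; [LawsonWuthrich2016].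
-/

set_option autoImplicit false
-- the Theorems namespace of this sub repeats the summit name by design (D-0017 nested layout)
set_option linter.dupNamespace false

noncomputable section

open scoped Classical

open CategoryTheory Field NumberField IsDedekindDomain Function
open _root_.WeierstrassCurve
open Literature.NumberTheory.EllipticCurves
open Literature.NumberTheory.GaloisRepresentations
open Literature.NumberTheory.GaloisCohomology
open Summit.BirchSwinnertonDyer.Rank1Residual.X11b.KummerPT
open Summit.BirchSwinnertonDyer.Rank1Residual.X11b.FiniteDuality
open Summit.BirchSwinnertonDyer.Rank1Residual.X11b.Relaxation
open scoped ContRepresentation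

namespace Summit.BirchSwinnertonDyer.BirchSwinnertonDyer.Theorems.GenusExact.DeepOwnPrime

open Summit.BirchSwinnertonDyer.BirchSwinnertonDyer.Theorems.GenusExact.RelaxedCount

/-! ## §1 Step 1 of the deep auxiliary as a lemma: the family of local conditions -/

section Family

variable (W : WeierstrassCurve ℚ) [W.IsElliptic] [W.IsGloballyMinimal]
variable (e : geomTorsion W ((2 ^ 2 : ℕ) : ℤ) → geomTorsion W ((2 ^ 2 : ℕ) : ℤ) → AlgebraicClosure ℚ)
  (hμ : ∀ S T, e S T ^ (2 ^ 2) = 1)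
  (hadd₁ : ∀ S₁ S₂ T, e (S₁ + S₂) T = e S₁ T * e S₂ T)
  (hadd₂ : ∀ S T₁ T₂, e S (T₁ + T₂) = e S T₁ * e S T₂)
  (hgal : ∀ (σ : absoluteGaloisGroup ℚ) (S T : geomTorsion W ((2 ^ 2 : ℕ) : ℤ)), σ • e S T = e (σ • S) (σ • T))
  (halt : ∀ T, e T T = 1) (hnondeg : ∀ T, (∀ S, e S T = 1) → T = 0)
  (inv : LocalInvariants ℚ (2 ^ 2))

include halt hnondeg in
/-- **The family of local conditions of the deep auxiliary** (Step 1 of `exists_auxiliary_four_two_nsmul_ne_zero_deep`, as a lemma):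
at every place `u ∈ T` a subgroup `M_u ≤ H¹(ℚ_u, E[4])` with `8 ≤ #M_u`, `M_u = ⊤` if `u ∈ s`, and for `u = v ∉ s`: every global `y`
with `loc_u y ∈ M_u` is orthogonal at `v` to `loc(2•Z)` for every `Z` with `2•Z` transverse at `v` (`∀ 𝔓 ∀ F ∀ c₀` form).
[cite: McCallumLMS1991, §5 Lemma 5.3 and proof of Prop. 5.2 (13)] -/
theorem exists_localConditions_deep (hΔ : W.Δ < 0)
    {K : Type} [Field K] [NumberField K] (T s : Finset (Place ℚ))
    (hTK : ∀ u ∈ T, ∃ (v : HeightOneSpectrum (𝓞 ℚ)) (ℓ : ℕ) (_ : Fact ℓ.Prime), u = Sum.inr v ∧ ℓ ≠ 2 ∧ (ℓ : 𝓞 ℚ) ∈ v.asIdeal ∧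
      W.HasGoodReductionAtPrime ℓ ∧ FrobEqFrobInfty W K 2 ℓ ∧ 2 ≤ Zhang2014.kolyvaginIndex W 2 ℓ)
    (ht4 : ∀ (v : HeightOneSpectrum (𝓞 ℚ)) (ℓ : ℕ), ℓ.Prime → Sum.inr v ∈ T → Sum.inr v ∉ s → (ℓ : 𝓞 ℚ) ∈ v.asIdeal →
      FrobEqFrobInfty W K (2 ^ 2) ℓ)
    (hinv : ∀ v : HeightOneSpectrum (𝓞 ℚ), Sum.inr v ∈ T → Injective (inv (Sum.inr v))) :
    ∃ M : ∀ u : ↥T, AddSubgroup (galoisCohomology ((W.torsionGaloisModule ((2 ^ 2 : ℕ) : ℤ)).toLocal (u : Place ℚ)) 1),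
      (∀ u : ↥T, 8 ≤ Nat.card (M u)) ∧ (∀ u : ↥T, (u : Place ℚ) ∈ s → M u = ⊤) ∧
      (∀ u : ↥T, ∀ v : HeightOneSpectrum (𝓞 ℚ), (u : Place ℚ) = Sum.inr v → (u : Place ℚ) ∉ s →
        ∀ Z : galoisCohomology (W.torsionGaloisModule ((2 ^ 2 : ℕ) : ℤ)) 1,
          (∀ 𝔓 ∈ v.primesAbove, ∀ F c₀ : absoluteGaloisGroup ℚ, IsArithFrobAt (𝓞 ℚ) F 𝔓 →
            IsComplexConjugation (Rat.castHom ℝ) c₀ → (∀ P : geomTorsion W ((2 ^ 2 : ℕ) : ℤ), F • P = c₀ • P) →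
            ∃ P₁ : geomTorsion W ((2 ^ 2 : ℕ) : ℤ), h1Eval W _ ((2 : ℕ) • Z) F = F • P₁ - P₁) →
          ∀ y : galoisCohomology (W.torsionGaloisModule ((2 ^ 2 : ℕ) : ℤ)) 1,
            galoisCohomology.localization (W.torsionGaloisModule ((2 ^ 2 : ℕ) : ℤ)) (u : Place ℚ) 1 y ∈ M u →
            invWeilPairing W (2 ^ 2) e hμ hadd₁ hadd₂ hgal inv (Sum.inr v)
              (galoisCohomology.localization (W.torsionGaloisModule ((2 ^ 2 : ℕ) : ℤ)) (Sum.inr v) 1 ((2 : ℕ) • Z))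
              (galoisCohomology.localization (W.torsionGaloisModule ((2 ^ 2 : ℕ) : ℤ)) (Sum.inr v) 1 y) = 0) := by
  classical
  have key : ∀ u : ↥T, ∃ M : AddSubgroup (galoisCohomology ((W.torsionGaloisModule ((2 ^ 2 : ℕ) : ℤ)).toLocal (u : Place ℚ)) 1),
      8 ≤ Nat.card M ∧ ((u : Place ℚ) ∈ s → M = ⊤) ∧
      (∀ v : HeightOneSpectrum (𝓞 ℚ), (u : Place ℚ) = Sum.inr v → (u : Place ℚ) ∉ s →
        ∀ Z : galoisCohomology (W.torsionGaloisModule ((2 ^ 2 : ℕ) : ℤ)) 1,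
          (∀ 𝔓 ∈ v.primesAbove, ∀ F c₀ : absoluteGaloisGroup ℚ, IsArithFrobAt (𝓞 ℚ) F 𝔓 →
            IsComplexConjugation (Rat.castHom ℝ) c₀ → (∀ P : geomTorsion W ((2 ^ 2 : ℕ) : ℤ), F • P = c₀ • P) →
            ∃ P₁ : geomTorsion W ((2 ^ 2 : ℕ) : ℤ), h1Eval W _ ((2 : ℕ) • Z) F = F • P₁ - P₁) →
          ∀ y : galoisCohomology (W.torsionGaloisModule ((2 ^ 2 : ℕ) : ℤ)) 1,
            galoisCohomology.localization (W.torsionGaloisModule ((2 ^ 2 : ℕ) : ℤ)) (u : Place ℚ) 1 y ∈ M →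
            invWeilPairing W (2 ^ 2) e hμ hadd₁ hadd₂ hgal inv (Sum.inr v)
              (galoisCohomology.localization (W.torsionGaloisModule ((2 ^ 2 : ℕ) : ℤ)) (Sum.inr v) 1 ((2 : ℕ) • Z))
              (galoisCohomology.localization (W.torsionGaloisModule ((2 ^ 2 : ℕ) : ℤ)) (Sum.inr v) 1 y) = 0) := by
    rintro ⟨u, huT⟩
    obtain ⟨v, ℓ, hℓp, hu, hℓ2, hv, hgood, hFrob, hidx⟩ := hTK u huT
    subst hu
    have h16 : Nat.card (galoisCohomology ((W.torsionGaloisModule ((2 ^ 2 : ℕ) : ℤ)).toLocal (Sum.inr v)) 1) = 16 := by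
      rw [natCard_galoisCohomology_one_toLocal_two_pow_eq W hΔ hℓ2 hgood hFrob hv two_ne_zero hidx]; norm_num
    by_cases hus : (Sum.inr v : Place ℚ) ∈ s
    · refine ⟨⊤, ?_, fun _ ↦ rfl, fun _ _ h ↦ (h hus).elim⟩
      change 8 ≤ Nat.card (⊤ : AddSubgroup (galoisCohomology ((W.torsionGaloisModule ((2 ^ 2 : ℕ) : ℤ)).toLocal (Sum.inr v)) 1))
      rw [AddSubgroup.card_top, h16]; norm_num
    · have hℓ4 : FrobEqFrobInfty W K (2 ^ 2) ℓ := ht4 v ℓ hℓp.out huT hus hv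
      obtain ⟨M, hM8, hM⟩ := exists_localCondition_eight_le_forall W e hμ hadd₁ hadd₂ hgal halt hnondeg inv hΔ hℓ2 hgood hℓ4 hv
        hidx (hinv v huT)
      refine ⟨M, hM8, fun h ↦ (hus h).elim, fun v' hv' _ Z hZ y hy ↦ ?_⟩
      have hvv' : v = v' := Sum.inr_injective hv'
      subst hvv'
      exact hM Z hZ _ hy
  choose M hM8 hMtop hMdeep using key
  exact ⟨M, hM8, hMtop, hMdeep⟩

include halt hnondeg in
/-- **The deep auxiliary avoiding `B`.**  As `exists_auxiliary_four_two_nsmul_ne_zero_deep` (p703833) with `2•y ≠ 0` replaced by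
**`2•y ∉ B`** for a finite set `B` of global classes with `#B < 2^{#s}` (`s ⊆ T` the free places). [cite: McCallumLMS1991, §5 proof of Prop. 5.2]
[cite: MilneADT2006, Ch. I, Thm. 4.10] -/
theorem exists_auxiliary_four_two_nsmul_not_mem_deep (hΔ : W.Δ < 0) (hρ2 : W.HasSurjectiveModNGaloisRep 2)
    {K : Type} [Field K] [NumberField K] (T s : Finset (Place ℚ)) (hsT : s ⊆ T)
    (hTK : ∀ u ∈ T, ∃ (v : HeightOneSpectrum (𝓞 ℚ)) (ℓ : ℕ) (_ : Fact ℓ.Prime), u = Sum.inr v ∧ ℓ ≠ 2 ∧ (ℓ : 𝓞 ℚ) ∈ v.asIdeal ∧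
      W.HasGoodReductionAtPrime ℓ ∧ FrobEqFrobInfty W K 2 ℓ ∧ 2 ≤ Zhang2014.kolyvaginIndex W 2 ℓ)
    (ht4 : ∀ (v : HeightOneSpectrum (𝓞 ℚ)) (ℓ : ℕ), ℓ.Prime → Sum.inr v ∈ T → Sum.inr v ∉ s → (ℓ : 𝓞 ℚ) ∈ v.asIdeal →
      FrobEqFrobInfty W K (2 ^ 2) ℓ)
    (hinv : ∀ v : HeightOneSpectrum (𝓞 ℚ), Sum.inr v ∈ T → Injective (inv (Sum.inr v)))
    (B : Finset (galoisCohomology (W.torsionGaloisModule ((2 ^ 2 : ℕ) : ℤ)) 1)) (hB : B.card < 2 ^ s.card) :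
    ∃ y ∈ kummerOutside W (2 ^ 2) T, (2 : ℕ) • y ∉ B ∧
      ∀ v : HeightOneSpectrum (𝓞 ℚ), Sum.inr v ∈ T → Sum.inr v ∉ s →
        ∀ Z : galoisCohomology (W.torsionGaloisModule ((2 ^ 2 : ℕ) : ℤ)) 1,
          (∀ 𝔓 ∈ v.primesAbove, ∀ F c₀ : absoluteGaloisGroup ℚ, IsArithFrobAt (𝓞 ℚ) F 𝔓 →
            IsComplexConjugation (Rat.castHom ℝ) c₀ → (∀ P : geomTorsion W ((2 ^ 2 : ℕ) : ℤ), F • P = c₀ • P) →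
            ∃ P₁ : geomTorsion W ((2 ^ 2 : ℕ) : ℤ), h1Eval W _ ((2 : ℕ) • Z) F = F • P₁ - P₁) →
          invWeilPairing W (2 ^ 2) e hμ hadd₁ hadd₂ hgal inv (Sum.inr v)
            (galoisCohomology.localization (W.torsionGaloisModule ((2 ^ 2 : ℕ) : ℤ)) (Sum.inr v) 1 ((2 : ℕ) • Z))
            (galoisCohomology.localization (W.torsionGaloisModule ((2 ^ 2 : ℕ) : ℤ)) (Sum.inr v) 1 y) = 0 := by
  classical
  obtain ⟨M, hM8, hMtop, hMdeep⟩ := exists_localConditions_deep W e hμ hadd₁ hadd₂ hgal halt hnondeg inv hΔ T s hTK ht4 hinv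
  obtain ⟨y, hyKO, hyM, hyB⟩ := exists_mem_kummerOutside_four_two_nsmul_not_mem_of_free W hΔ hρ2 T hTK M B s hsT hB
    (fun u hu ↦ hMtop u hu) hM8
  refine ⟨y, hyKO, hyB, fun v hvT hvs Z hZ ↦ ?_⟩
  exact hMdeep ⟨Sum.inr v, hvT⟩ v rfl hvs Z hZ y (hyM ⟨Sum.inr v, hvT⟩)

include halt hnondeg in
/-- **Auxiliary + reciprocity, avoiding `B`.**  As `exists_auxiliary_bottomRung` (p703833) with **`2•y ∉ B`** (`#B < 2^{#s}`): the engine's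
`hstep` may be restricted to the auxiliaries `y` with `2•y ∉ B` (e.g. `B = {0, φ₄}`, two free own primes).
[cite: McCallumLMS1991, §5 proof of Prop. 5.2] [cite: MilneADT2006, Ch. I, Thm. 4.10] -/
theorem exists_auxiliary_bottomRung_not_mem (hΔ : W.Δ < 0) (hρ2 : W.HasSurjectiveModNGaloisRep 2)
    {K : Type} [Field K] [NumberField K] (s t : Finset (Place ℚ)) (hst : Disjoint s t)
    (hTK : ∀ u ∈ s ∪ t, ∃ (v : HeightOneSpectrum (𝓞 ℚ)) (ℓ : ℕ) (_ : Fact ℓ.Prime), u = Sum.inr v ∧ ℓ ≠ 2 ∧ (ℓ : 𝓞 ℚ) ∈ v.asIdeal ∧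
      W.HasGoodReductionAtPrime ℓ ∧ FrobEqFrobInfty W K 2 ℓ ∧ 2 ≤ Zhang2014.kolyvaginIndex W 2 ℓ)
    (ht4 : ∀ (v : HeightOneSpectrum (𝓞 ℚ)) (ℓ : ℕ), ℓ.Prime → Sum.inr v ∈ t → (ℓ : 𝓞 ℚ) ∈ v.asIdeal →
      FrobEqFrobInfty W K (2 ^ 2) ℓ)
    (hinv : ∀ v : HeightOneSpectrum (𝓞 ℚ), Sum.inr v ∈ s ∪ t → Injective (inv (Sum.inr v)))
    (hsum : inv.SumLocalTermEqZero)
    (B : Finset (galoisCohomology (W.torsionGaloisModule ((2 ^ 2 : ℕ) : ℤ)) 1)) (hB : B.card < 2 ^ s.card) :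
    ∃ y ∈ kummerOutside W (2 ^ 2) (s ∪ t), (2 : ℕ) • y ∉ B ∧
      ∀ l' : Place ℚ, l' ∉ s ∪ t →
        ∀ Z : galoisCohomology (W.torsionGaloisModule ((2 ^ 2 : ℕ) : ℤ)) 1,
          (2 : ℕ) • Z ∈ kummerOutside W (2 ^ 2) (insert l' (s ∪ t)) →
          (∀ u ∈ s, galoisCohomology.localization (W.torsionGaloisModule ((2 ^ 2 : ℕ) : ℤ)) u 1 ((2 : ℕ) • Z) = 0) →
          (∀ v : HeightOneSpectrum (𝓞 ℚ), Sum.inr v ∈ t →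
            ∀ 𝔓 ∈ v.primesAbove, ∀ F c₀ : absoluteGaloisGroup ℚ, IsArithFrobAt (𝓞 ℚ) F 𝔓 →
              IsComplexConjugation (Rat.castHom ℝ) c₀ → (∀ P : geomTorsion W ((2 ^ 2 : ℕ) : ℤ), F • P = c₀ • P) →
              ∃ P₁ : geomTorsion W ((2 ^ 2 : ℕ) : ℤ), h1Eval W _ ((2 : ℕ) • Z) F = F • P₁ - P₁) →
          invWeilPairing W (2 ^ 2) e hμ hadd₁ hadd₂ hgal inv l'
            (galoisCohomology.localization (W.torsionGaloisModule ((2 ^ 2 : ℕ) : ℤ)) l' 1 ((2 : ℕ) • Z))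
            (galoisCohomology.localization (W.torsionGaloisModule ((2 ^ 2 : ℕ) : ℤ)) l' 1 y) = 0 := by
  haveI : NeZero (2 ^ 2) := ⟨by norm_num⟩
  have ht4' : ∀ (v : HeightOneSpectrum (𝓞 ℚ)) (ℓ : ℕ), ℓ.Prime → Sum.inr v ∈ s ∪ t → Sum.inr v ∉ s → (ℓ : 𝓞 ℚ) ∈ v.asIdeal →
      FrobEqFrobInfty W K (2 ^ 2) ℓ := fun v ℓ hℓ hvT hvs hv ↦
    ht4 v ℓ hℓ ((Finset.mem_union.mp hvT).resolve_left hvs) hv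
  obtain ⟨y, hyKO, hyB, hdeep⟩ := exists_auxiliary_four_two_nsmul_not_mem_deep W e hμ hadd₁ hadd₂ hgal halt hnondeg inv hΔ hρ2
    (s ∪ t) s Finset.subset_union_left hTK ht4' hinv B hB
  refine ⟨y, hyKO, hyB, fun l' hl' Z hX hXs hZt ↦ ?_⟩
  have hl's : l' ∉ s := fun h ↦ hl' (Finset.mem_union_left t h)
  have hl't : l' ∉ t := fun h ↦ hl' (Finset.mem_union_right s h)
  have hy' : y ∈ kummerOutside W (2 ^ 2) (insert l' (s ∪ t)) :=
    kummerOutside_mono W (2 ^ 2) (Finset.subset_insert l' (s ∪ t)) hyKO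
  refine invWeilPairing_eq_zero_of_bottomRung_of_vanishing W (2 ^ 2) e hμ hadd₁ hadd₂ hgal halt hsum s t l' hl's hl't hst hX hy'
    hXs fun u hu ↦ ?_
  obtain ⟨v, ℓ, hℓp, huv, -⟩ := hTK u (Finset.mem_union_right s hu)
  subst huv
  have hvs : (Sum.inr v : Place ℚ) ∉ s := fun h ↦ Finset.disjoint_left.mp hst h hu
  exact hdeep v (Finset.mem_union_right s hu) hvs Z (hZt v hu)

include halt hnondeg in
/-- **Auxiliary + reciprocity avoiding `B`, for THE canonical family** (`inv`-hypotheses discharged). [cite: MilneADT2006, Ch. I, Thm. 4.10] -/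
theorem exists_auxiliary_bottomRung_not_mem_canonical (hΔ : W.Δ < 0) (hρ2 : W.HasSurjectiveModNGaloisRep 2)
    {K : Type} [Field K] [NumberField K] (s t : Finset (Place ℚ)) (hst : Disjoint s t)
    (hTK : ∀ u ∈ s ∪ t, ∃ (v : HeightOneSpectrum (𝓞 ℚ)) (ℓ : ℕ) (_ : Fact ℓ.Prime), u = Sum.inr v ∧ ℓ ≠ 2 ∧ (ℓ : 𝓞 ℚ) ∈ v.asIdeal ∧
      W.HasGoodReductionAtPrime ℓ ∧ FrobEqFrobInfty W K 2 ℓ ∧ 2 ≤ Zhang2014.kolyvaginIndex W 2 ℓ)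
    (ht4 : ∀ (v : HeightOneSpectrum (𝓞 ℚ)) (ℓ : ℕ), ℓ.Prime → Sum.inr v ∈ t → (ℓ : 𝓞 ℚ) ∈ v.asIdeal →
      FrobEqFrobInfty W K (2 ^ 2) ℓ)
    (B : Finset (galoisCohomology (W.torsionGaloisModule ((2 ^ 2 : ℕ) : ℤ)) 1)) (hB : B.card < 2 ^ s.card) :
    ∃ y ∈ kummerOutside W (2 ^ 2) (s ∪ t), (2 : ℕ) • y ∉ B ∧
      ∀ l' : Place ℚ, l' ∉ s ∪ t →
        ∀ Z : galoisCohomology (W.torsionGaloisModule ((2 ^ 2 : ℕ) : ℤ)) 1,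
          (2 : ℕ) • Z ∈ kummerOutside W (2 ^ 2) (insert l' (s ∪ t)) →
          (∀ u ∈ s, galoisCohomology.localization (W.torsionGaloisModule ((2 ^ 2 : ℕ) : ℤ)) u 1 ((2 : ℕ) • Z) = 0) →
          (∀ v : HeightOneSpectrum (𝓞 ℚ), Sum.inr v ∈ t →
            ∀ 𝔓 ∈ v.primesAbove, ∀ F c₀ : absoluteGaloisGroup ℚ, IsArithFrobAt (𝓞 ℚ) F 𝔓 →
              IsComplexConjugation (Rat.castHom ℝ) c₀ → (∀ P : geomTorsion W ((2 ^ 2 : ℕ) : ℤ), F • P = c₀ • P) →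
              ∃ P₁ : geomTorsion W ((2 ^ 2 : ℕ) : ℤ), h1Eval W _ ((2 : ℕ) • Z) F = F • P₁ - P₁) →
          invWeilPairing W (2 ^ 2) e hμ hadd₁ hadd₂ hgal (LocalInvariants.canonical ℚ (2 ^ 2)) l'
            (galoisCohomology.localization (W.torsionGaloisModule ((2 ^ 2 : ℕ) : ℤ)) l' 1 ((2 : ℕ) • Z))
            (galoisCohomology.localization (W.torsionGaloisModule ((2 ^ 2 : ℕ) : ℤ)) l' 1 y) = 0 := by
  haveI : NeZero (2 ^ 2) := ⟨by norm_num⟩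
  exact exists_auxiliary_bottomRung_not_mem W e hμ hadd₁ hadd₂ hgal halt hnondeg (LocalInvariants.canonical ℚ (2 ^ 2)) hΔ hρ2 s t hst
    hTK ht4 (fun v _ ↦ ((LocalInvariants.canonical_isPerfect (K := ℚ) (n := 2 ^ 2)) v).1.1)
    (Summit.BirchSwinnertonDyer.BirchSwinnertonDyer.Theorems.SchneiderFreeAdditiveX3.PoitouTateReduction.sumLocalTermEqZero_canonical
      (K := ℚ) (2 ^ 2)) B hB

end Family

end Summit.BirchSwinnertonDyer.BirchSwinnertonDyer.Theorems.GenusExact.DeepOwnPrime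

/-! ## §2 The LEAD's one-step engine with `hstep` restricted to `2•y ∉ B` -/

open Field NumberField IsDedekindDomain Function WeierstrassCurve
open Literature.NumberTheory.EllipticCurves
open Literature.NumberTheory.GaloisRepresentations
open Literature.NumberTheory.GaloisCohomology
open Summit.BirchSwinnertonDyer.Rank1Residual.X11b.FiniteDuality
open Summit.BirchSwinnertonDyer.Rank1Residual.X11b.Relaxation
open Summit.BirchSwinnertonDyer.BirchSwinnertonDyer.Theorems.GenusExact.SelmerDescent
open Summit.BirchSwinnertonDyer.BirchSwinnertonDyer.Theorems.GenusExact.DeepOwnPrime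
open Summit.BirchSwinnertonDyer.BirchSwinnertonDyer.Theorems.SchneiderFreeAdditiveX3.PoitouTateReduction

namespace Summit.BirchSwinnertonDyer.BirchSwinnertonDyer.Theorems.GenusExact.RelaxedCount

variable (W : WeierstrassCurve ℚ) [W.IsElliptic] [W.IsGloballyMinimal]

/-- **The one-step engine of the bottom rung (index `≥ 2`, even depth), modulo named inputs, with the auxiliary avoiding `B`.**
As the LEAD's `false_of_bottomRung_engine`, but `hstep` is required only for the auxiliaries `y` with `2•y ∉ B`, `#B < 2^{#s}`.  `E/ℚ` globally minimal, `Δ < 0`, `ρ̄_{E,2}`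
onto; `K = ℚ(θ)`, `θ² = c`, imaginary quadratic; `s ≠ ∅` (free) and `t` (deep) disjoint sets of places of Gross–Kolyvagin primes of index `≥ 2`
(`Frob = Frob_∞` on `E[4]` on `t`).  Suppose that for EVERY auxiliary `y ∈ H¹_{𝓛,⊤ on s∪t}(ℚ, E[4])` with `2y ≠ 0` one can find (as the
Kolyvagin machine does: Čebotarev prime `ℓ′` for `(c(n), res_K y)`, `Z = desc c(nℓ′)`): a new Gross–Kolyvagin prime `ℓ′ ∉ s ∪ t`, `ℓ′ ∤ 2c`,
inert `λ′ ∣ ℓ′`, of index `≥ 2` with `Frob = Frob_∞` on `E[4]`; classes `Z ∈ H¹(ℚ, E[4])`, `c_K = c(n)`, `c_K′ = c(nℓ′)` with `res_K Z = c_K′`;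
(Kum) `c_K′` Kummer at the places of `K` over every `v ∉ s ∪ t ∪ {ℓ′}`; (Q2) at `λ′`; (Čeb) order clauses with exponent `2` for `c_K` and
`res_K y` at `λ′`; for each free `ℓ ∈ s`: inert `λ ∣ ℓ`, `ℓ ∤ c`, `Frob = Frob_∞` on `E[4]`, a class `c_K^{(ℓ)} = c((n/ℓ)ℓ′)` with Q2's second
clause at `λ` (`j = 1`) and (M) `2 • c_K^{(ℓ)} = 0`; (tr) `2•Z` transverse at the places of `t`.  Then `False` — so the `k`-minimal
primitive product has NO free own prime (`k = 0`): the bottom rung closes. [cite: McCallumLMS1991, §5 proof of Prop. 5.2]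
[cite: GrossLMS1991, Prop. 6.2 and §9] [cite: MilneADT2006, Ch. I, Thm. 4.10] -/
theorem false_of_bottomRung_engine_not_mem (hΔ : W.Δ < 0) (hρ2 : W.HasSurjectiveModNGaloisRep 2)
    {K : Type} [Field K] [NumberField K] (hK : IsImaginaryQuadratic K) {θ : K} (hθ : θ ∉ (algebraMap ℚ K).range) {c : ℤ}
    (hc : θ ^ 2 = algebraMap ℚ K c)
    (s t : Finset (Place ℚ)) (hst : Disjoint s t)
    (B : Finset (galoisCohomology (W.torsionGaloisModule ((2 ^ 2 : ℕ) : ℤ)) 1)) (hB : B.card < 2 ^ s.card)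
    (hTK : ∀ u ∈ s ∪ t, ∃ (v : HeightOneSpectrum (𝓞 ℚ)) (ℓ : ℕ) (_ : Fact ℓ.Prime), u = Sum.inr v ∧ ℓ ≠ 2 ∧ (ℓ : 𝓞 ℚ) ∈ v.asIdeal ∧
      W.HasGoodReductionAtPrime ℓ ∧ FrobEqFrobInfty W K 2 ℓ ∧ 2 ≤ Zhang2014.kolyvaginIndex W 2 ℓ)
    (ht4 : ∀ (v : HeightOneSpectrum (𝓞 ℚ)) (ℓ : ℕ), ℓ.Prime → Sum.inr v ∈ t → (ℓ : 𝓞 ℚ) ∈ v.asIdeal →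
      FrobEqFrobInfty W K (2 ^ 2) ℓ)
    (hstep : ∀ y ∈ kummerOutside W (2 ^ 2) (s ∪ t), (2 : ℕ) • y ∉ B →
      ∃ (v' : HeightOneSpectrum (𝓞 ℚ)) (ℓ' : ℕ) (_ : Fact ℓ'.Prime) (w' : HeightOneSpectrum (𝓞 K))
        (_ : w'.asIdeal.LiesOver v'.asIdeal) (Z : galoisCohomology (W.torsionGaloisModule ((2 ^ 2 : ℕ) : ℤ)) 1)
        (cK cK' : galH1Torsion (W.baseChange K) ((2 ^ 2 : ℕ) : ℤ)),
        (Sum.inr v' : Place ℚ) ∉ s ∪ t ∧ ℓ' ≠ 2 ∧ (ℓ' : 𝓞 ℚ) ∈ v'.asIdeal ∧ W.HasGoodReductionAtPrime ℓ' ∧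
        ((c : ℤ) : 𝓞 ℚ) ∉ v'.asIdeal ∧ FrobEqFrobInfty W K (2 ^ 2) ℓ' ∧ 2 ≤ Zhang2014.kolyvaginIndex W 2 ℓ' ∧
        w'.asIdeal.inertiaDeg (𝓞 ℚ) = 2 ∧
        resTorsion W K ((2 ^ 2 : ℕ) : ℤ) Z = cK' ∧
        (∀ v : HeightOneSpectrum (𝓞 ℚ), (Sum.inr v : Place ℚ) ∉ insert (Sum.inr v' : Place ℚ) (s ∪ t) →
          ∀ w : HeightOneSpectrum (𝓞 K), w.asIdeal.LiesOver v.asIdeal →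
            cK' ∈ selmerLocalKer (W.baseChange K) (w.adicCompletion K) ((2 ^ 2 : ℕ) : ℤ)) ∧
        (∀ j : ℕ,
          (((2 ^ j : ℕ) : ℤ) • cK' ∈ selmerLocalKer (W.baseChange K) (w'.adicCompletion K) ((2 ^ 2 : ℕ) : ℤ) ↔
            ((2 ^ j : ℕ) : ℤ) • cK' ∈ (W.baseChange K).torsionLocalKer (w'.adicCompletion K) ((2 ^ 2 : ℕ) : ℤ)) ∧
          (((2 ^ j : ℕ) : ℤ) • cK' ∈ (W.baseChange K).torsionLocalKer (w'.adicCompletion K) ((2 ^ 2 : ℕ) : ℤ) ↔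
            ((2 ^ j : ℕ) : ℤ) • cK ∈ (W.baseChange K).torsionLocalKer (w'.adicCompletion K) ((2 ^ 2 : ℕ) : ℤ))) ∧
        (∀ j : ℕ, ((2 ^ j : ℕ) : ℤ) • cK ∈ (W.baseChange K).torsionLocalKer (w'.adicCompletion K) ((2 ^ 2 : ℕ) : ℤ) ↔ 2 ≤ j) ∧
        (∀ j : ℕ, ((2 ^ j : ℕ) : ℤ) • resTorsion W K ((2 ^ 2 : ℕ) : ℤ) y ∈
          (W.baseChange K).torsionLocalKer (w'.adicCompletion K) ((2 ^ 2 : ℕ) : ℤ) ↔ 2 ≤ j) ∧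
        (∀ u ∈ s, ∃ (v : HeightOneSpectrum (𝓞 ℚ)) (ℓ : ℕ) (w : HeightOneSpectrum (𝓞 K)) (_ : w.asIdeal.LiesOver v.asIdeal)
          (cKu : galH1Torsion (W.baseChange K) ((2 ^ 2 : ℕ) : ℤ)),
          u = Sum.inr v ∧ ℓ.Prime ∧ (ℓ : 𝓞 ℚ) ∈ v.asIdeal ∧ ((c : ℤ) : 𝓞 ℚ) ∉ v.asIdeal ∧ FrobEqFrobInfty W K (2 ^ 2) ℓ ∧
          w.asIdeal.inertiaDeg (𝓞 ℚ) = 2 ∧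
          (((2 ^ 1 : ℕ) : ℤ) • cK' ∈ (W.baseChange K).torsionLocalKer (w.adicCompletion K) ((2 ^ 2 : ℕ) : ℤ) ↔
            ((2 ^ 1 : ℕ) : ℤ) • cKu ∈ (W.baseChange K).torsionLocalKer (w.adicCompletion K) ((2 ^ 2 : ℕ) : ℤ)) ∧
          (2 : ℤ) • cKu = 0) ∧
        (∀ v : HeightOneSpectrum (𝓞 ℚ), Sum.inr v ∈ t →
          ∀ 𝔓 ∈ v.primesAbove, ∀ F c₀ : absoluteGaloisGroup ℚ, IsArithFrobAt (𝓞 ℚ) F 𝔓 →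
            IsComplexConjugation (Rat.castHom ℝ) c₀ → (∀ P : geomTorsion W ((2 ^ 2 : ℕ) : ℤ), F • P = c₀ • P) →
            ∃ P₁ : geomTorsion W ((2 ^ 2 : ℕ) : ℤ), h1Eval W _ ((2 : ℕ) • Z) F = F • P₁ - P₁)) :
    False := by
  haveI : NeZero (2 ^ 2) := ⟨by norm_num⟩
  have h2K : Module.finrank ℚ K = 2 := hK.1
  -- a Weil pairing at level `4` (tree theorem) and the canonical Poitou–Tate family
  obtain ⟨e, hμ, hadd₁, hadd₂, halt, hnondeg, hgal⟩ := W.exists_weilPairing_holds (2 ^ 2) (by norm_num) (by norm_num)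
  set inv : LocalInvariants ℚ (2 ^ 2) := LocalInvariants.canonical ℚ (2 ^ 2) with hinvdef
  have hperf := LocalInvariants.canonical_isPerfect (K := ℚ) (n := 2 ^ 2)
  -- the auxiliary class and the reciprocity it feeds
  obtain ⟨y, hyKO, hy2, hrec⟩ := exists_auxiliary_bottomRung_not_mem W e hμ hadd₁ hadd₂ hgal halt hnondeg inv hΔ hρ2 s t hst hTK
    ht4 (fun v _ ↦ (hperf v).1.1) (sumLocalTermEqZero_canonical (K := ℚ) (2 ^ 2)) B hB
  -- the step data for this `y`
  obtain ⟨v', ℓ', hℓ'p, w', hw', Z, cK, cK', hv'out, hℓ'2, hℓ'v, hgood', hcv', hFrob4', hidx', hf', hZ, hKum, hRel, hOrdZ, hOrdY,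
    hfree, htr⟩ := hstep y hyKO hy2
  have hgoodv' : W.HasGoodReductionAt v' := VisiblePairAtTwo.hasGoodReductionAt_of_hasGoodReductionAtPrime W hgood' hℓ'v
  have hFrob2' : FrobEqFrobInfty W K 2 ℓ' := hFrob4'.of_dvd ⟨2, by norm_num⟩
  have h22 : (1 : ℕ) ≤ 2 := by norm_num
  -- (hX): `2•Z` Kummer off `s ∪ t ∪ {ℓ′}`
  have hX : (2 : ℕ) • Z ∈ kummerOutside W (2 ^ 2) (insert (Sum.inr v' : Place ℚ) (s ∪ t)) :=
    two_nsmul_mem_kummerOutside_of_isImaginaryQuadratic W K hK (2 ^ 2) _ Z fun v hv w hw ↦ by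
      haveI := hw
      rw [hZ]
      exact hKum v hv w hw
  -- (hXs): `loc_u (2•Z) = 0` at the free primes
  have hXs : ∀ u ∈ s, galoisCohomology.localization (W.torsionGaloisModule ((2 ^ 2 : ℕ) : ℤ)) u 1 ((2 : ℕ) • Z) = 0 := by
    intro u hu
    obtain ⟨v, ℓ, w, hw, cKu, huv, hℓp, hℓv, hcv, hFrob4, hf, hRel₁, hcKu⟩ := hfree u hu
    obtain ⟨v₀, ℓ₀, hℓ₀p, huv₀, hℓ₀2, hℓ₀v, hgood₀, -, -⟩ := hTK u (Finset.mem_union_left t hu)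
    subst huv
    have hvv : v = v₀ := Sum.inr_injective huv₀
    subst hvv
    haveI := hw
    -- `ℓ = ℓ₀`: both lie in `v`
    have hℓℓ : ℓ = ℓ₀ := by
      have h1 := VisiblePairAtTwo.natGenerator_eq_of_natCast_prime_mem hℓp hℓv
      have h2 := VisiblePairAtTwo.natGenerator_eq_of_natCast_prime_mem hℓ₀p.out hℓ₀v
      exact h1.symm.trans h2
    subst hℓℓ
    have hgoodv : W.HasGoodReductionAt v := VisiblePairAtTwo.hasGoodReductionAt_of_hasGoodReductionAtPrime W hgood₀ hℓv
    exact localization_two_nsmul_eq_zero_of_K W hΔ h22 (q := 2 ^ 2) rfl hℓp hℓ₀2 hℓv hgoodv h2K hθ hc hcv hFrob4 w hf hZ hRel₁ hcKu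
  -- the `ℓ′`-term vanishes …
  have hzero := hrec (Sum.inr v') hv'out Z hX hXs htr
  -- … and does not vanish
  have hyK : y ∈ selmerLocalKer W (v'.adicCompletion ℚ) ((2 ^ 2 : ℕ) : ℤ) :=
    (res_mem_kummerLocalConditionAt_iff W ((2 ^ 2 : ℕ) : ℤ) (Place.Completion (Sum.inr v' : Place ℚ)) y).mp
      ((mem_kummerOutside_iff W (2 ^ 2) (s ∪ t) y).mp hyKO _ hv'out)
  have hOrdYℚ : ∀ j : ℕ, ((2 ^ j : ℕ) : ℤ) • y ∈ W.torsionLocalKer (v'.adicCompletion ℚ) ((2 ^ 2 : ℕ) : ℤ) ↔ 2 ≤ j := fun j ↦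
    (zsmul_mem_torsionLocalKer_iff_resTorsion_of_notMem W hΔ h22 (q := 2 ^ 2) rfl hℓ'p.out hℓ'2 hℓ'v hgoodv' h2K hθ hc hcv'
      hFrob4' w' hf' y _).trans (hOrdY j)
  obtain ⟨hmeet, hz'⟩ := bottomRung_newPrime_inputs_of_K W hΔ h22 (q := 2 ^ 2) rfl hℓ'p.out hℓ'2 hℓ'v hgoodv' h2K hθ hc hcv'
    hFrob4' w' hf' hZ hRel hOrdZ
  have hz : (2 : ℤ) • galoisCohomology.localization (W.torsionGaloisModule ((2 ^ 2 : ℕ) : ℤ)) (Sum.inr v') 1 Z ≠ 0 := by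
    have h21 : ((2 ^ (2 - 1) : ℕ) : ℤ) = 2 := by norm_num
    rwa [h21] at hz'
  have hF := annLeft_invWeilPairing_kummerSelmerStructure_le_canonical W e hμ hadd₁ hadd₂ hgal halt hnondeg (p := 2) (k := 2)
    two_ne_zero v' (LocalDualityOrder.two_notMem_of_odd_prime_mem hℓ'2 hℓ'v)
  exact invWeilPairing_localization_ne_zero_of_newPrime W (2 ^ 2) e hμ hadd₁ hadd₂ hgal hΔ hℓ'2 hgood' hFrob2' hℓ'v h22 hidx' rfl
    inv hF hyK hOrdYℚ hmeet hz hzero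

end Summit.BirchSwinnertonDyer.BirchSwinnertonDyer.Theorems.GenusExact.RelaxedCount

end
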